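/-
Copyright (c) 2026 the pub-hodgecm-mathlib formalisation cell (harness21).  Prover seat hodgecm-mathlib-K2E3-p03 (g11), Track B «K2-LIT»,
hLiu418 = `stmt-HodgeConjecture-24832`; K1a (C-K) desk K2E4-p10 (g11), LEAD F0P6-plan (g16) BATCH #297 (3) ∕ #299 (3): (C-K-3)(L) FILE A1 —
THE GAIN KERNEL `|det(g + ix)|^{−σ}·(x₀₀² + p²)^{−1/2}` ON `Herm₂(ℂ)` IS INTEGRABLE FOR `σ > 2`, AND GAINED WEIGHTED ξ-INTEGRALS ARE HOLOMORPHIC ON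
`{re(α+β) > 2 + m}`.  THEOREMS ONLY (no `def`, no `instance`, no notation, no named-fact hypothesis, no `sorry`); lane
`--supports stmt-HodgeConjecture-24832 --as helper`.
-/
import Summits.HodgeConjecture.HodgeConjecture.Theorems.K2LiuHermTwoConfluentXiHolomorphy     -- ★ `hasDerivAt_xiTwoIntegrand_affine`, `norm_xiTwoIntegrand_le`, `rpow_neg_le_add`
import Literature.Analysis.Complex.HolomorphicParametricIntegral                               -- ★ `differentiableOn_integral_of_dominated`
import HarnessLib

/-!
# Crux `HLiu418`, K1-a♮ (C-K-3)(L) FILE A1: the GAIN KERNEL and holomorphy of gained weighted ξ-integrals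

Cell `hodgecm-mathlib`, crux item hLiu418 = `stmt-HodgeConjecture-24832` (helper lane `--supports … --as helper`, count-neutral), route of record
`HCCMUnconditional`; squad K2 ∕ K2Liu.  First of three files proving the CROSSING LEMMA «the twisted big-cell block of a flat `K_w`-finite Siegel
section is holomorphic across `re s = ½`» (census `K2/K2E3-p03/g11/CENSUS-CK3-L-crossing.md`, road: ONE Euler integration by parts at a rank-one
phase).  The Euler integration by parts (FILE A3) rewrites a weighted confluent integral `∫ W·ξ-integrand(g, h; α, β)` as a sum of integrals whose
integrands are `(bounded) × |det(g + ix)|^{−re(α+β)} × (x₀₀² + p²)^{−1/2}` (`p = re g₀₀ > 0`); THIS FILE supplies their convergence and holomorphy: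
* §1 **(E1) `integrable_gainKernel`** — `x ↦ |det(g + ix)|^{−σ}·(x₀₀² + p²)^{−1/2}` is integrable on `Herm₂(ℂ) ≅ ℝ × ℂ × ℝ` for `σ > 2` (one unit
  below Shimura's abscissa `3`): the `(z, b)`-fibres integrate to `M·(a² + p²)^{1−σ/2}` by ★ `K2LiuHermTwoDetPowerIntegrable.integral_kernel_fibre_zb`
  (`σ > 2`), and the extra factor `(a² + p²)^{−1/2}` makes the `a`-integral ★ `integrable_sq_add_const_rpow` at `σ + 1`; the majorant principle
  `integrable_of_norm_le_gain` (`‖F‖ ≤ K·|det|^m·(x₀₀²+p²)^{−1/2}·‖ξ-integrand(α,β)‖`, `re(α+β) > 2 + m` ⇒ `F` integrable);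
* §2 **`differentiableOn_weighted`** — for a measurable weight `ω` with `‖ω(x)‖ ≤ K·|det(g+ix)|^m·(x₀₀² + p²)^{−1/2}`,
  `s ↦ ∫ ω(x)·ξ-integrand(g, h; a + s, b + s)(x) dx` is holomorphic on `{s | 2 + m < re(a + b + 2s)}` (dominated holomorphic parametric integral, ★
  `Literature…differentiableOn_integral_of_dominated`, the domination pattern of ★ `differentiableOn_xiTwo_diag`), and `integrable_weighted`.
References: [Shimura1982, §1 (1.25)–(1.26), §3]; [Shimura1997, §16.4].
HONEST LABEL.  Count-neutral helper; closes no socket: HC_CM is proved only modulo the 7 printed citations (2 remaining named inputs: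
hLiu418 = `stmt-HodgeConjecture-24832`, h413 = `stmt-HodgeConjecture-24833`) until rung 0 closes.
-/

set_option autoImplicit false
-- the mandated namespace repeats the single-problem summit's segment (`HodgeConjecture.HodgeConjecture`)
set_option linter.dupNamespace false

noncomputable section

open Complex MeasureTheory Set Metric
open scoped ComplexOrder ComplexConjugate

namespace Summit.HodgeConjecture.HodgeConjecture.Cruxes.HLiu418.K2LiuHermTwoXiGainKernel

open Summit.HodgeConjecture.HodgeConjecture.Cruxes.HLiu418.K2LiuHermTwoGammaDefs
open Summit.HodgeConjecture.HodgeConjecture.Cruxes.HLiu418.K2LiuHermTwoDetPowerFibres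
open Summit.HodgeConjecture.HodgeConjecture.Cruxes.HLiu418.K2LiuHermTwoDetPowerIntegrable
open Summit.HodgeConjecture.HodgeConjecture.Cruxes.HLiu418.K2LiuHermTwoConfluentXiDefs
open Summit.HodgeConjecture.HodgeConjecture.Cruxes.HLiu418.K2LiuHermTwoConfluentXiConvergence
open Summit.HodgeConjecture.HodgeConjecture.Cruxes.HLiu418.K2LiuHermTwoConfluentXiHolomorphy

/-! ## §1 (E1): the gain kernel `|det(g + ix)|^{−σ}·(x₀₀² + p²)^{−1/2}` is integrable for `σ > 2` -/

/-- **(E1), CHART FORM**: for `g = hermTwo (p, w, q) > 0` and `σ > 2`, `x ↦ |det(g + ix)|^{−σ}·(x₀₀² + p²)^{−1/2}` is integrable on `Herm₂(ℂ) ≅ ℝ × ℂ × ℝ`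
(the `(z, b)`-fibres integrate to `M·(a² + p²)^{1−σ/2}` by ★ `integral_kernel_fibre_zb`; one more factor `(a²+p²)^{−1/2}` makes the `a`-integral
converge for `σ > 2`, ★ `integrable_sq_add_const_rpow` at `σ + 1`). [cite: Shimura1982, §1 (1.26)] -/
theorem integrable_gainKernel_hermTwo (d : ℝ × ℂ × ℝ) (hd : 0 < d.1 ∧ normSq d.2.1 < d.1 * d.2.2) {σ : ℝ} (hσ : 2 < σ) :
    Integrable (fun c : ℝ × ℂ × ℝ => ‖(hermTwo d + I • hermTwo c).det‖ ^ (-σ) * (c.1 ^ 2 + d.1 ^ 2) ^ (-(1 / 2 : ℝ))) := by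
  obtain ⟨p, w, q⟩ := d
  have hp : 0 < p := hd.1
  have hpq : normSq w < p * q := hd.2
  -- the kernel of ★ `K2LiuHermTwoDetPowerIntegrable` with its section data, kept opaque
  obtain ⟨ν, hν⟩ : ∃ ν : ℝ → ℂ → ℝ, ∀ (a : ℝ) (z : ℂ), ν a z =
      (p * ‖z - ((a / p : ℝ) : ℂ) * w‖ ^ 2 + (a ^ 2 + p ^ 2) * (p * q - normSq w) / p) / (a ^ 2 + p ^ 2) := ⟨_, fun _ _ => rfl⟩
  obtain ⟨μ, hμ⟩ : ∃ μ : ℝ → ℂ → ℝ, ∀ (a : ℝ) (z : ℂ), μ a z =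
      (p * (q * a - 2 * (w * conj z).re) - a * (p * q - normSq w + normSq z)) / (a ^ 2 + p ^ 2) := ⟨_, fun _ _ => rfl⟩
  obtain ⟨F, hF⟩ : ∃ F : ℝ × ℂ × ℝ → ℝ, ∀ c : ℝ × ℂ × ℝ,
      F c = ((c.1 ^ 2 + p ^ 2) * ((c.2.2 + μ c.1 c.2.1) ^ 2 + (ν c.1 c.2.1) ^ 2)) ^ (-σ / 2) := ⟨_, fun _ => rfl⟩
  have hmeas : Measurable F := measurable_kernel (p := p) (q := q) (w := w) (σ := σ) ν hν μ hμ F hF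
  have hFnn : ∀ c, 0 ≤ F c := kernel_nonneg (p := p) (σ := σ) ν μ F hF
  have hzb : ∀ a : ℝ, Integrable (fun zb : ℂ × ℝ => F (a, zb)) ((volume : Measure ℂ).prod (volume : Measure ℝ)) :=
    fun a => integrable_kernel_fibre_zb (p := p) (q := q) (w := w) (σ := σ) ν hν μ hμ F hF hp hpq hσ a
  have hIzb : ∀ a : ℝ, ∫ zb : ℂ × ℝ, F (a, zb) =
      ((∫ t : ℝ, (1 + t ^ 2) ^ (-σ / 2)) * (∫ u : ℂ, (1 + ‖u‖ ^ 2) ^ (1 - σ)) *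
          ((p * q - normSq w) / p) ^ (1 - σ) * ((p * q - normSq w) / p ^ 2)) * (a ^ 2 + p ^ 2) ^ (1 - σ / 2) :=
    fun a => integral_kernel_fibre_zb (p := p) (q := q) (w := w) (σ := σ) ν hν μ hμ F hF hp hpq hσ a
  -- the weighted kernel `F · (a² + p²)^{−1/2}`
  obtain ⟨r, hr⟩ : ∃ r : ℝ → ℝ, ∀ a : ℝ, r a = (a ^ 2 + p ^ 2) ^ (-(1 / 2 : ℝ)) := ⟨_, fun _ => rfl⟩
  have hrnn : ∀ a, 0 ≤ r a := fun a => by rw [hr]; exact Real.rpow_nonneg (by positivity) _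
  have hrm : Measurable r := by
    have e : r = fun a : ℝ => (a ^ 2 + p ^ 2) ^ (-(1 / 2 : ℝ)) := funext hr
    rw [e]
    fun_prop
  have htarget : (fun c : ℝ × ℂ × ℝ => ‖(hermTwo (p, w, q) + I • hermTwo c).det‖ ^ (-σ) * (c.1 ^ 2 + (p, w, q).1 ^ 2) ^ (-(1 / 2 : ℝ))) =
      fun c => F c * r c.1 := by
    funext c
    obtain ⟨a, z, b⟩ := c
    have e1 : F (a, z, b) = ‖(hermTwo (p, w, q) + I • hermTwo (a, z, b)).det‖ ^ (-σ) := by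
      rw [hF, hμ, hν, norm_det_rpow_neg_eq hp σ a z b]
    rw [e1, hr]
  rw [htarget]
  have hm2 : Measurable (fun c : ℝ × ℂ × ℝ => F c * r c.1) := hmeas.mul (hrm.comp measurable_fst)
  rw [Measure.volume_eq_prod, integrable_prod_iff hm2.aestronglyMeasurable]
  refine ⟨Filter.Eventually.of_forall fun a => (hzb a).mul_const (r a), ?_⟩
  -- the `a`-function is `M · (a² + p²)^{1 − (σ+1)/2}`
  have e : (fun a : ℝ => ∫ zb : ℂ × ℝ, ‖F (a, zb) * r (a, zb).1‖) =
      fun a => ((∫ t : ℝ, (1 + t ^ 2) ^ (-σ / 2)) * (∫ u : ℂ, (1 + ‖u‖ ^ 2) ^ (1 - σ)) *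
        ((p * q - normSq w) / p) ^ (1 - σ) * ((p * q - normSq w) / p ^ 2)) * (a ^ 2 + p ^ 2) ^ (1 - (σ + 1) / 2) := by
    funext a
    have e1 : (fun zb : ℂ × ℝ => ‖F (a, zb) * r (a, zb).1‖) = fun zb => F (a, zb) * r a := by
      funext zb
      exact Real.norm_of_nonneg (mul_nonneg (hFnn _) (hrnn _))
    have hX : 0 < a ^ 2 + p ^ 2 := by positivity
    rw [e1, integral_mul_const, hIzb a, hr, mul_assoc, ← Real.rpow_add hX]
    congr 2
    ring
  rw [e]
  exact (integrable_sq_add_const_rpow hp (by linarith : 3 < σ + 1)).const_mul _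

/-- **(E1)**: for `g` positive definite and `σ > 2`, `x ↦ |det(g + ix)|^{−σ}·(x₀₀² + (re g₀₀)²)^{−1/2}` is integrable on `Herm₂(ℂ)`. [cite: Shimura1982, §1 (1.26)] -/
theorem integrable_gainKernel {g : Matrix (Fin 2) (Fin 2) ℂ} (hg : g.PosDef) {σ : ℝ} (hσ : 2 < σ) :
    Integrable (fun c : ℝ × ℂ × ℝ => ‖(g + I • hermTwo c).det‖ ^ (-σ) * (c.1 ^ 2 + (g 0 0).re ^ 2) ^ (-(1 / 2 : ℝ))) := by
  have hg' : hermTwo ((g 0 0).re, g 0 1, (g 1 1).re) = g := hermTwo_eq_of_isHermitian hg.1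
  have hd := (posDef_hermTwo_iff ((g 0 0).re, g 0 1, (g 1 1).re)).mp (hg'.symm ▸ hg)
  have h := integrable_gainKernel_hermTwo _ hd hσ
  rw [hg'] at h
  exact h

/-- **THE MAJORANT PRINCIPLE WITH GAIN**: a measurable `F` with `‖F(x)‖ ≤ K·|det(g+ix)|^m·(x₀₀²+p²)^{−1/2}·‖ξ-integrand(g,h;α,β)(x)‖` is integrable as soon as
`re(α+β) > 2 + m` (`p = re g₀₀`; ★ `norm_xiTwoIntegrand_le` and §1). [cite: Shimura1982, §1 (1.26)] -/
theorem integrable_of_norm_le_gain {g h : Matrix (Fin 2) (Fin 2) ℂ} (hg : g.PosDef) (hh : h.IsHermitian) {α β : ℂ} {m K : ℝ} (hK : 0 ≤ K)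
    (hσ : 2 + m < (α + β).re) {F : ℝ × ℂ × ℝ → ℂ} (hF : AEStronglyMeasurable F (volume : Measure (ℝ × ℂ × ℝ)))
    (hle : ∀ c, ‖F c‖ ≤ K * (‖(g + I • hermTwo c).det‖ ^ m * (c.1 ^ 2 + (g 0 0).re ^ 2) ^ (-(1 / 2 : ℝ))) * ‖xiTwoIntegrand g h α β c‖) :
    Integrable F := by
  have hI := (integrable_gainKernel hg (σ := (α + β).re - m) (by linarith)).const_mul (K * Real.exp (2 * Real.pi * (|α.im| + |β.im|)))
  refine Integrable.mono' hI hF (Filter.Eventually.of_forall fun c => ?_)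
  have hDpos : 0 < ‖(g + I • hermTwo c).det‖ := norm_det_add_I_smul_pos hg c
  have hΦ := norm_xiTwoIntegrand_le hg hh α β c
  have hgain : 0 ≤ (c.1 ^ 2 + (g 0 0).re ^ 2) ^ (-(1 / 2 : ℝ)) := Real.rpow_nonneg (by positivity) _
  have hpow : ‖(g + I • hermTwo c).det‖ ^ m * ‖(g + I • hermTwo c).det‖ ^ (-(α + β).re) = ‖(g + I • hermTwo c).det‖ ^ (-((α + β).re - m)) := by
    rw [← Real.rpow_add hDpos]
    congr 1
    ring
  calc ‖F c‖ ≤ K * (‖(g + I • hermTwo c).det‖ ^ m * (c.1 ^ 2 + (g 0 0).re ^ 2) ^ (-(1 / 2 : ℝ))) * ‖xiTwoIntegrand g h α β c‖ := hle c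
    _ ≤ K * (‖(g + I • hermTwo c).det‖ ^ m * (c.1 ^ 2 + (g 0 0).re ^ 2) ^ (-(1 / 2 : ℝ))) *
        (Real.exp (2 * Real.pi * (|α.im| + |β.im|)) * ‖(g + I • hermTwo c).det‖ ^ (-(α + β).re)) :=
      mul_le_mul_of_nonneg_left hΦ (mul_nonneg hK (mul_nonneg (Real.rpow_nonneg hDpos.le _) hgain))
    _ = K * Real.exp (2 * Real.pi * (|α.im| + |β.im|)) *
        (‖(g + I • hermTwo c).det‖ ^ (-((α + β).re - m)) * (c.1 ^ 2 + (g 0 0).re ^ 2) ^ (-(1 / 2 : ℝ))) := by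
      rw [← hpow]
      ring

/-! ## §2 Holomorphy of gained weighted integrals along the diagonal -/

/-- The ξ-integrand is ENTIRE in the diagonal parameter: `s ↦ ξ-integrand(g, h; a + s, b + s)(x)` (`g > 0`). [folklore] -/
theorem differentiable_xiTwoIntegrand_diag_of_posDef {g : Matrix (Fin 2) (Fin 2) ℂ} (hg : g.PosDef) (h : Matrix (Fin 2) (Fin 2) ℂ) (a b : ℂ) (c : ℝ × ℂ × ℝ) :
    Differentiable ℂ (fun s : ℂ => xiTwoIntegrand g h (a + s) (b + s) c) := by
  have e : (fun s : ℂ => xiTwoIntegrand g h (a + s) (b + s) c) = fun s : ℂ => xiTwoIntegrand g h (a + 1 * s) (b + 1 * s) c := by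
    simp only [one_mul]
  rw [e]
  exact fun s => (hasDerivAt_xiTwoIntegrand_affine hg a b 1 1 c s).differentiableAt

/-- **HOLOMORPHY OF A GAINED WEIGHTED ξ-INTEGRAL**: for `g > 0`, `h` Hermitian and a measurable weight `ω` with
`‖ω(x)‖ ≤ K·|det(g+ix)|^m·(x₀₀² + p²)^{−1/2}` (`p = re g₀₀`), the function `s ↦ ∫ ω(x)·ξ-integrand(g, h; a+s, b+s)(x) dx` is holomorphic on
`{s | 2 + m < re(a + b + 2s)}` (dominated holomorphic parametric integral, ★ `differentiableOn_integral_of_dominated`; local majorant from §1).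
[cite: Shimura1982, §3] [cite: Shimura1997, §16.4] -/
theorem differentiableOn_weighted {g h : Matrix (Fin 2) (Fin 2) ℂ} (hg : g.PosDef) (hh : h.IsHermitian) {ω : ℝ × ℂ × ℝ → ℂ}
    (hω : AEStronglyMeasurable ω (volume : Measure (ℝ × ℂ × ℝ))) {m K : ℝ} (hK : 0 ≤ K)
    (hle : ∀ c, ‖ω c‖ ≤ K * (‖(g + I • hermTwo c).det‖ ^ m * (c.1 ^ 2 + (g 0 0).re ^ 2) ^ (-(1 / 2 : ℝ)))) (a b : ℂ) :
    DifferentiableOn ℂ (fun s : ℂ => ∫ c : ℝ × ℂ × ℝ, ω c * xiTwoIntegrand g h (a + s) (b + s) c) {s : ℂ | 2 + m < (a + b + 2 * s).re} := by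
  refine Literature.Analysis.Complex.differentiableOn_integral_of_dominated (μ := (volume : Measure (ℝ × ℂ × ℝ)))
    (F := fun s c => ω c * xiTwoIntegrand g h (a + s) (b + s) c)
    (fun s _ => hω.mul (aestronglyMeasurable_xiTwoIntegrand g h (a + s) (b + s)))
    (Filter.Eventually.of_forall fun c => ((differentiable_const _).mul (differentiable_xiTwoIntegrand_diag_of_posDef hg h a b c)).differentiableOn)
    fun s₀ hs₀ => ?_
  -- the local domination around `s₀`
  set t₀ : ℝ := (a + b + 2 * s₀).re with ht₀
  have ht₀' : 2 + m < t₀ := hs₀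
  set R : ℝ := (t₀ - 2 - m) / 4 with hR
  have hRpos : 0 < R := by rw [hR]; linarith
  set t₁ : ℝ := t₀ - 2 * R with ht₁
  set t₂ : ℝ := t₀ + 2 * R with ht₂
  have ht₁2 : 2 < t₁ - m := by rw [ht₁, hR]; linarith
  have ht₂2 : 2 < t₂ - m := by rw [ht₂, hR]; linarith
  set M : ℝ := ‖a‖ + ‖b‖ + 2 * (‖s₀‖ + R) with hM
  set C₀ : ℝ := K * Real.exp (2 * Real.pi * M) with hC₀
  have hC₀nn : 0 ≤ C₀ := by positivity
  -- points of the ball: exponent between `t₁` and `t₂`, imaginary parts at most `M`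
  have hball : ∀ s ∈ ball s₀ R, (t₁ ≤ (a + s + (b + s)).re ∧ (a + s + (b + s)).re ≤ t₂) ∧ |(a + s).im| + |(b + s).im| ≤ M := by
    intro s hs
    have hsd : ‖s - s₀‖ < R := by rw [← dist_eq_norm]; exact hs
    have hs' : ‖s‖ ≤ ‖s₀‖ + R := by have := norm_sub_norm_le s s₀; linarith
    refine ⟨?_, ?_⟩
    · have hre : (a + s + (b + s)).re = t₀ + 2 * (s - s₀).re := by
        rw [ht₀]; simp only [add_re, sub_re, mul_re, re_ofNat, im_ofNat]; ring
      rw [hre, ht₁, ht₂]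
      have := Complex.abs_re_le_norm (s - s₀)
      constructor <;> linarith [neg_abs_le (s - s₀).re, le_abs_self (s - s₀).re]
    · have h1 : |(a + s).im| ≤ ‖a‖ + ‖s‖ := (Complex.abs_im_le_norm _).trans (norm_add_le _ _)
      have h2 : |(b + s).im| ≤ ‖b‖ + ‖s‖ := (Complex.abs_im_le_norm _).trans (norm_add_le _ _)
      rw [hM]
      linarith
  refine ⟨R, hRpos, fun s hs => ?_, fun c => C₀ * (‖(g + I • hermTwo c).det‖ ^ (-(t₁ - m)) * (c.1 ^ 2 + (g 0 0).re ^ 2) ^ (-(1 / 2 : ℝ)) +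
      ‖(g + I • hermTwo c).det‖ ^ (-(t₂ - m)) * (c.1 ^ 2 + (g 0 0).re ^ 2) ^ (-(1 / 2 : ℝ))), ?_, ?_⟩
  · -- the ball lies in the half-plane
    show 2 + m < (a + b + 2 * s).re
    have h1 := (hball s hs).1.1
    have e : (a + s + (b + s)).re = (a + b + 2 * s).re := by congr 1; ring
    linarith [e ▸ h1]
  · -- the majorant is integrable
    exact ((integrable_gainKernel hg ht₁2).add (integrable_gainKernel hg ht₂2)).const_mul C₀
  · -- the domination
    refine Filter.Eventually.of_forall fun c s hs => ?_
    obtain ⟨⟨hre₁, hre₂⟩, him⟩ := hball s hs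
    have hDpos : 0 < ‖(g + I • hermTwo c).det‖ := norm_det_add_I_smul_pos hg c
    set nD : ℝ := ‖(g + I • hermTwo c).det‖ with hnD
    set G : ℝ := (c.1 ^ 2 + (g 0 0).re ^ 2) ^ (-(1 / 2 : ℝ)) with hG
    have hGnn : 0 ≤ G := Real.rpow_nonneg (by positivity) _
    have hexp : Real.exp (2 * Real.pi * (|(a + s).im| + |(b + s).im|)) ≤ Real.exp (2 * Real.pi * M) :=
      Real.exp_le_exp.mpr (mul_le_mul_of_nonneg_left him (by positivity))
    have hpow : nD ^ (-(a + s + (b + s)).re) ≤ nD ^ (-t₁) + nD ^ (-t₂) :=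
      Literature.Dynamics.TransferOperators.rpow_neg_le_add hDpos hre₁ hre₂
    have hΦ : ‖xiTwoIntegrand g h (a + s) (b + s) c‖ ≤ Real.exp (2 * Real.pi * M) * (nD ^ (-t₁) + nD ^ (-t₂)) :=
      (norm_xiTwoIntegrand_le hg hh _ _ c).trans (mul_le_mul hexp hpow (Real.rpow_nonneg hDpos.le _) (Real.exp_pos _).le)
    have hm₁ : nD ^ m * nD ^ (-t₁) = nD ^ (-(t₁ - m)) := by rw [← Real.rpow_add hDpos]; congr 1; ring
    have hm₂ : nD ^ m * nD ^ (-t₂) = nD ^ (-(t₂ - m)) := by rw [← Real.rpow_add hDpos]; congr 1; ring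
    calc ‖ω c * xiTwoIntegrand g h (a + s) (b + s) c‖ = ‖ω c‖ * ‖xiTwoIntegrand g h (a + s) (b + s) c‖ := norm_mul _ _
      _ ≤ (K * (nD ^ m * G)) * (Real.exp (2 * Real.pi * M) * (nD ^ (-t₁) + nD ^ (-t₂))) :=
        mul_le_mul (hle c) hΦ (norm_nonneg _) (mul_nonneg hK (mul_nonneg (Real.rpow_nonneg hDpos.le _) hGnn))
      _ = C₀ * (nD ^ (-(t₁ - m)) * G + nD ^ (-(t₂ - m)) * G) := by
        rw [hC₀, ← hm₁, ← hm₂]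
        ring

/-- Integrability of a gained weighted ξ-integrand on the shifted half-space `{2 + m < re(α+β)}` (§1). -/
theorem integrable_weighted {g h : Matrix (Fin 2) (Fin 2) ℂ} (hg : g.PosDef) (hh : h.IsHermitian) {ω : ℝ × ℂ × ℝ → ℂ}
    (hω : AEStronglyMeasurable ω (volume : Measure (ℝ × ℂ × ℝ))) {m K : ℝ} (hK : 0 ≤ K)
    (hle : ∀ c, ‖ω c‖ ≤ K * (‖(g + I • hermTwo c).det‖ ^ m * (c.1 ^ 2 + (g 0 0).re ^ 2) ^ (-(1 / 2 : ℝ)))) {α β : ℂ}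
    (hσ : 2 + m < (α + β).re) :
    Integrable (fun c : ℝ × ℂ × ℝ => ω c * xiTwoIntegrand g h α β c) :=
  integrable_of_norm_le_gain hg hh hK hσ (hω.mul (aestronglyMeasurable_xiTwoIntegrand g h α β)) fun c => by
    rw [norm_mul]
    exact mul_le_mul_of_nonneg_right (hle c) (norm_nonneg _)

end Summit.HodgeConjecture.HodgeConjecture.Cruxes.HLiu418.K2LiuHermTwoXiGainKernel

end
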